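import Literature.GroupTheory.CombinatorialGroupTheory.RandomSclFreeGroupTripodCounts
import Literature.GroupTheory.CombinatorialGroupTheory.RandomSclFreeGroupSubwordCounts
import HarnessLib

/-!
# Random rigidity of scl (Calegari–Walker 2013): proofs, part 20 — the tripod bound for a word
with equidistributed subwords

D. Calegari, A. Walker, *Random rigidity in the free group*, Geom. Topol. 17 (2013)
[CalegariWalker2013], §4.3 (proof of Prop. 4.2): for a word `w ∈ F_n'` all of whose subwords of
lengths `2h + 2` and `h + 2` occur the expected number of times up to a factor `1 ± η`
(Prop. 2.3), the tripod fatgraph of `four_mul_cl_pow_le_of_patternCounts` certifies an upper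
bound for `scl(w)` of the form `n/(12h) (1 + O(hη) + O(h²/n))`.

* **`card_corner_windows_eq`, `card_siteB_windows_le`, `le_card_siteB_windows_add`,
  `card_siteA_windows_le`** — the pattern counts of `four_mul_cl_pow_le_of_patternCounts`
  (indexed by corners) versus the subword counts of `card_filter_subwordCount_ge_le` (indexed by
  `J`, gap `g = h`).
* **`scl_le_of_subwordCounts`** — the deterministic bound for `scl(w)` from two-sided bounds on
  the subword counts.
* **`card_filter_badCounts_le`** — the words with a badly distributed subword of length `2h + 2`
  or `h + 2` are rare (union bound over `card_filter_subwordCount_ge_le` / `_le_le`).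
-/

noncomputable section

namespace Literature.GroupTheory.CombinatorialGroupTheory

section Reindexing

open Finset

/-- **Corner-indexed versus `J`-indexed counts, length `2h+2`.** With gap `g = h`, the number
of corners `c ∈ [2h+3, n−h−1]` whose `2h+2` letters from `c − h − 1` spell `τ` equals the number
of `J ∈ [1, n − 3h − 3]` with the subword `τ` at `J + h + 1`. [folklore] -/
theorem card_corner_windows_eq {k n : ℕ} (w : Fin n → Fin k × Bool) (vg : ℕ → Fin k × Bool)
    (hvg : ∀ i (hi : i < n), vg i = w ⟨i, hi⟩) (h : ℕ) (τ : ℕ → Fin k × Bool) :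
    ((Finset.Icc (2 * h + 3) (n - h - 1)).filter fun c =>
        ∀ i, i < 2 * h + 2 → vg (c - h - 1 + i) = τ i).card =
      ((Finset.range (n - (h + 1 + (2 * h + 1)))).filter fun J => 1 ≤ J ∧
        ∃ hJ : J + (h + 1) + (2 * h + 1) < n, ∀ q : Fin (2 * h + 1 + 1),
          w ⟨J + (h + 1) + q, by omega⟩ = τ q).card := by
  classical
  refine Finset.card_bij (fun c _ => c - (2 * h + 2)) ?_ ?_ ?_
  · intro c hc
    rw [Finset.mem_filter, Finset.mem_Icc] at hc
    obtain ⟨⟨hc1, hc2⟩, hwin⟩ := hc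
    rw [Finset.mem_filter, Finset.mem_range]
    refine ⟨by omega, by omega, by omega, fun q => ?_⟩
    have e := hwin q q.isLt
    have e1 : c - h - 1 + q = c - (2 * h + 2) + (h + 1) + q := by omega
    rw [e1, hvg _ (by omega)] at e
    exact e
  · intro c hc c' hc' heq
    rw [Finset.mem_filter, Finset.mem_Icc] at hc hc'
    omega
  · intro J hJ
    rw [Finset.mem_filter, Finset.mem_range] at hJ
    obtain ⟨hJ1, hJ2, hJ3, hwin⟩ := hJ
    refine ⟨J + (2 * h + 2), ?_, by omega⟩
    rw [Finset.mem_filter, Finset.mem_Icc]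
    refine ⟨⟨by omega, by omega⟩, fun i hi => ?_⟩
    have e := hwin ⟨i, by omega⟩
    have e1 : J + (2 * h + 2) - h - 1 + i = J + (h + 1) + i := by omega
    rw [e1, hvg _ (by omega)]
    exact e

/-- **Sites over `a` (positions `b − 1`, `b ∈ [2h+3, n−h−1]`) inject into the `J`-indexed
count of length `h + 2`, gap `h`.** [folklore] -/
theorem card_siteB_windows_le {k n : ℕ} (w : Fin n → Fin k × Bool) (vg : ℕ → Fin k × Bool)
    (hvg : ∀ i (hi : i < n), vg i = w ⟨i, hi⟩) (h : ℕ) (ρ : ℕ → Fin k × Bool) :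
    ((Finset.Icc (2 * h + 3) (n - h - 1)).filter fun b =>
        ∀ j, j < h + 2 → vg (b - 1 + j) = ρ j).card ≤
      ((Finset.range (n - (h + 1 + (h + 1)))).filter fun J => 1 ≤ J ∧
        ∃ hJ : J + (h + 1) + (h + 1) < n, ∀ q : Fin (h + 1 + 1),
          w ⟨J + (h + 1) + q, by omega⟩ = ρ q).card := by
  classical
  refine Finset.card_le_card_of_injOn (fun b => b - (h + 2)) ?_ ?_
  · intro b hb
    rw [Finset.mem_coe, Finset.mem_filter, Finset.mem_Icc] at hb
    obtain ⟨⟨hb1, hb2⟩, hwin⟩ := hb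
    dsimp only
    rw [Finset.mem_coe, Finset.mem_filter, Finset.mem_range]
    refine ⟨by omega, by omega, by omega, fun q => ?_⟩
    have e := hwin q q.isLt
    have e1 : b - 1 + q = b - (h + 2) + (h + 1) + q := by omega
    rw [e1, hvg _ (by omega)] at e
    exact e
  · intro b hb b' hb' heq
    rw [Finset.mem_coe, Finset.mem_filter, Finset.mem_Icc] at hb hb'
    simp only at heq
    omega

/-- **Conversely, the `J`-indexed count of length `h + 2` exceeds the count over the sites by
at most `h`** (the positions `J ≤ h` are not sites). [folklore] -/
theorem le_card_siteB_windows_add {k n : ℕ} (w : Fin n → Fin k × Bool) (vg : ℕ → Fin k × Bool)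
    (hvg : ∀ i (hi : i < n), vg i = w ⟨i, hi⟩) (h : ℕ) (ρ : ℕ → Fin k × Bool) :
    ((Finset.range (n - (h + 1 + (h + 1)))).filter fun J => 1 ≤ J ∧
        ∃ hJ : J + (h + 1) + (h + 1) < n, ∀ q : Fin (h + 1 + 1),
          w ⟨J + (h + 1) + q, by omega⟩ = ρ q).card ≤
      ((Finset.Icc (2 * h + 3) (n - h - 1)).filter fun b =>
        ∀ j, j < h + 2 → vg (b - 1 + j) = ρ j).card + h := by
  classical
  set S := (Finset.range (n - (h + 1 + (h + 1)))).filter fun J => 1 ≤ J ∧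
      ∃ hJ : J + (h + 1) + (h + 1) < n, ∀ q : Fin (h + 1 + 1),
        w ⟨J + (h + 1) + q, by omega⟩ = ρ q with hS
  -- split `S` according to `J ≤ h`
  have hsplit := Finset.card_filter_add_card_filter_not (s := S) (fun J => h < J)
  have h1 : (S.filter fun J => h < J).card ≤ ((Finset.Icc (2 * h + 3) (n - h - 1)).filter fun b =>
      ∀ j, j < h + 2 → vg (b - 1 + j) = ρ j).card := by
    refine Finset.card_le_card_of_injOn (fun J => J + (h + 2)) ?_ ?_
    · intro J hJ
      rw [Finset.mem_coe, Finset.mem_filter, hS, Finset.mem_filter, Finset.mem_range] at hJ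
      obtain ⟨⟨hJ1, hJ2, hJ3, hwin⟩, hJh⟩ := hJ
      dsimp only
      rw [Finset.mem_coe, Finset.mem_filter, Finset.mem_Icc]
      refine ⟨⟨by omega, by omega⟩, fun j hj => ?_⟩
      have e := hwin ⟨j, by omega⟩
      have e1 : J + (h + 2) - 1 + j = J + (h + 1) + j := by omega
      rw [e1, hvg _ (by omega)]
      exact e
    · intro J _ J' _ heq
      simp only at heq
      omega
  have h2 : (S.filter fun J => ¬ h < J).card ≤ h := by
    calc (S.filter fun J => ¬ h < J).card ≤ (Finset.Icc 1 h).card := by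
          apply Finset.card_le_card
          intro J hJ
          rw [Finset.mem_filter, hS, Finset.mem_filter] at hJ
          rw [Finset.mem_Icc]
          omega
      _ = h := by simp
  omega

/-- **Sites with a given outgoing start (positions `a − h − 1`, `a ∈ [2h+3, n−h−1]`) inject
into the `J`-indexed count of length `h + 2`, gap `h`.** [folklore] -/
theorem card_siteA_windows_le {k n : ℕ} (w : Fin n → Fin k × Bool) (vg : ℕ → Fin k × Bool)
    (hvg : ∀ i (hi : i < n), vg i = w ⟨i, hi⟩) (h : ℕ) (ρ : ℕ → Fin k × Bool) :
    ((Finset.Icc (2 * h + 3) (n - h - 1)).filter fun a =>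
        ∀ j, j < h + 2 → vg (a - h - 1 + j) = ρ j).card ≤
      ((Finset.range (n - (h + 1 + (h + 1)))).filter fun J => 1 ≤ J ∧
        ∃ hJ : J + (h + 1) + (h + 1) < n, ∀ q : Fin (h + 1 + 1),
          w ⟨J + (h + 1) + q, by omega⟩ = ρ q).card := by
  classical
  refine Finset.card_le_card_of_injOn (fun a => a - (2 * h + 2)) ?_ ?_
  · intro a ha
    rw [Finset.mem_coe, Finset.mem_filter, Finset.mem_Icc] at ha
    obtain ⟨⟨ha1, ha2⟩, hwin⟩ := ha
    dsimp only
    rw [Finset.mem_coe, Finset.mem_filter, Finset.mem_range]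
    refine ⟨by omega, by omega, by omega, fun q => ?_⟩
    have e := hwin q q.isLt
    have e1 : a - h - 1 + q = a - (2 * h + 2) + (h + 1) + q := by omega
    rw [e1, hvg _ (by omega)] at e
    exact e
  · intro a ha a' ha' heq
    rw [Finset.mem_coe, Finset.mem_filter, Finset.mem_Icc] at ha ha'
    simp only at heq
    omega

end Reindexing

section PerWord

open Finset

/-- **The tripod bound for a single word (CW Prop. 4.2, deterministic form in the language of
subword counts).** Let `k ≥ 2`, `h = ℓ + 1`, `w ∈ F_n'`, and suppose that every reduced word of
length `2h + 2` occurs (at the positions `J + h + 1`, `1 ≤ J < n − 3h − 2`) between `Amin` and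
`Amax` times and every reduced word of length `h + 2` occurs (at `J + h + 1`,
`1 ≤ J < n − 2h − 2`) between `Bmin` and `Bmax` times. Then with `q = (2k−2)²`,
`N' = 3h · qBmax · qAmax`, `Tlow = (n − 3h − 3) · q(Bmin − h) · qAmin`,
`Uup = 3q ((Amax − Amin)(n − 3h − 3) qBmax + 2h Amax qBmax)`:
`4 N' scl(w) + (3h − 1) Tlow ≤ N' n + 2 + (h + 1) Uup`.
[cite: CalegariWalker2013, Prop. 4.2 (proof, §4.3)] -/
theorem scl_le_of_subwordCounts {k n : ℕ} (hk : 2 ≤ k) (w : Fin n → Fin k × Bool)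
    (hw : w ∈ commutatorWords k n) (ℓ : ℕ) (hn : ℓ + 2 ≤ n) (Amin Amax Bmin Bmax : ℕ)
    (hA : ∀ σ ∈ reducedWords k (2 * (ℓ + 1) + 1 + 1),
      Amin ≤ ((Finset.range (n - ((ℓ + 1) + 1 + (2 * (ℓ + 1) + 1)))).filter fun J => 1 ≤ J ∧
        ∃ hJ : J + ((ℓ + 1) + 1) + (2 * (ℓ + 1) + 1) < n, ∀ q : Fin (2 * (ℓ + 1) + 1 + 1),
          w ⟨J + ((ℓ + 1) + 1) + q, by omega⟩ = σ q).card ∧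
      ((Finset.range (n - ((ℓ + 1) + 1 + (2 * (ℓ + 1) + 1)))).filter fun J => 1 ≤ J ∧
        ∃ hJ : J + ((ℓ + 1) + 1) + (2 * (ℓ + 1) + 1) < n, ∀ q : Fin (2 * (ℓ + 1) + 1 + 1),
          w ⟨J + ((ℓ + 1) + 1) + q, by omega⟩ = σ q).card ≤ Amax)
    (hB : ∀ ρ ∈ reducedWords k ((ℓ + 1) + 1 + 1),
      Bmin ≤ ((Finset.range (n - ((ℓ + 1) + 1 + ((ℓ + 1) + 1)))).filter fun J => 1 ≤ J ∧
        ∃ hJ : J + ((ℓ + 1) + 1) + ((ℓ + 1) + 1) < n, ∀ q : Fin ((ℓ + 1) + 1 + 1),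
          w ⟨J + ((ℓ + 1) + 1) + q, by omega⟩ = ρ q).card ∧
      ((Finset.range (n - ((ℓ + 1) + 1 + ((ℓ + 1) + 1)))).filter fun J => 1 ≤ J ∧
        ∃ hJ : J + ((ℓ + 1) + 1) + ((ℓ + 1) + 1) < n, ∀ q : Fin ((ℓ + 1) + 1 + 1),
          w ⟨J + ((ℓ + 1) + 1) + q, by omega⟩ = ρ q).card ≤ Bmax) :
    4 * (((3 * (ℓ + 1) * (((2 * k - 2) * (2 * k - 2) * Bmax) *
        ((2 * k - 2) * (2 * k - 2) * Amax)) : ℕ) : ℝ) *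
        stableCommutatorLength (FreeGroup.mk (List.ofFn w))) +
      (((3 * (ℓ + 1) - 1) * ((n - ℓ - 1 - 1 + 1 - (2 * (ℓ + 1) + 3)) *
        ((2 * k - 2) * (2 * k - 2) * (Bmin - (ℓ + 1))) * ((2 * k - 2) * (2 * k - 2) * Amin)) : ℕ) : ℝ)
      ≤ (((3 * (ℓ + 1) * (((2 * k - 2) * (2 * k - 2) * Bmax) * ((2 * k - 2) * (2 * k - 2) * Amax)) * n
        + 2 + ((ℓ + 1) + 1) * (3 * ((2 * k - 2) * (2 * k - 2)) *
          ((Amax - Amin) * ((n - ℓ - 1 - 1 + 1 - (2 * (ℓ + 1) + 3)) * ((2 * k - 2) * (2 * k - 2) * Bmax))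
            + Amax * (2 * (ℓ + 1) * ((2 * k - 2) * (2 * k - 2) * Bmax))))) : ℕ) : ℝ) := by
  classical
  have hk0 : 0 < k := by omega
  rw [mem_commutatorWords_iff] at hw
  obtain ⟨hred, hvc⟩ := hw
  -- the letters as a function on `ℕ`
  let vg : ℕ → Fin k × Bool := fun i => if hi : i < n then w ⟨i, hi⟩ else (⟨0, hk0⟩, false)
  have hvg : ∀ i (hi : i < n), vg i = w ⟨i, hi⟩ := fun i hi => by simp [vg, hi]
  rw [reduce_ofFn_eq_self_iff] at hred
  have hred' : ∀ i, i + 1 < n → vg (i + 1) ≠ ((vg i).1, !(vg i).2) := by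
    intro i hi heq
    rw [hvg _ hi, hvg _ (by omega)] at heq
    have h1 := congrArg Prod.fst heq
    have h2 := congrArg Prod.snd heq
    simp only at h1 h2
    have h3 := hred i hi h1.symm
    rw [h3] at h2
    exact Bool.not_ne_self _ h2.symm
  -- reducedness of patterns in the two forms
  have hredτ : ∀ (L : ℕ) (τ : ℕ → Fin k × Bool),
      (∀ i, i + 1 < L + 1 → τ (i + 1) ≠ ((τ i).1, !(τ i).2)) →
      (fun q : Fin (L + 1) => τ q) ∈ reducedWords k (L + 1) := by
    intro L τ hτ
    rw [mem_reducedWords_iff, reduce_ofFn_eq_self_iff]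
    intro i hi h1
    by_contra h2
    apply hτ i hi
    have h1' : (τ i).1 = (τ (i + 1)).1 := h1
    have h2' : (τ i).2 ≠ (τ (i + 1)).2 := h2
    refine Prod.ext h1'.symm ?_
    simp only
    revert h2'
    cases (τ i).2 <;> cases (τ (i + 1)).2 <;> simp
  -- the pattern-count hypotheses in the corner-indexed form
  have hA' : ∀ τ : ℕ → Fin k × Bool,
      (∀ i, i + 1 < 2 * (ℓ + 1) + 2 → τ (i + 1) ≠ ((τ i).1, !(τ i).2)) →
      Amin ≤ ((Finset.Icc (2 * (ℓ + 1) + 3) (n - (ℓ + 1) - 1)).filter fun c =>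
        ∀ i, i < 2 * (ℓ + 1) + 2 → vg (c - (ℓ + 1) - 1 + i) = τ i).card ∧
      ((Finset.Icc (2 * (ℓ + 1) + 3) (n - (ℓ + 1) - 1)).filter fun c =>
        ∀ i, i < 2 * (ℓ + 1) + 2 → vg (c - (ℓ + 1) - 1 + i) = τ i).card ≤ Amax := by
    intro τ hτ
    rw [card_corner_windows_eq w vg hvg (ℓ + 1) τ]
    exact hA _ (hredτ _ τ hτ)
  have hB' : ∀ ρ : ℕ → Fin k × Bool,
      (∀ j, j + 1 < (ℓ + 1) + 2 → ρ (j + 1) ≠ ((ρ j).1, !(ρ j).2)) →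
      Bmin - (ℓ + 1) ≤ ((Finset.Icc (2 * (ℓ + 1) + 3) (n - (ℓ + 1) - 1)).filter fun b =>
        ∀ j, j < (ℓ + 1) + 2 → vg (b - 1 + j) = ρ j).card ∧
      ((Finset.Icc (2 * (ℓ + 1) + 3) (n - (ℓ + 1) - 1)).filter fun b =>
        ∀ j, j < (ℓ + 1) + 2 → vg (b - 1 + j) = ρ j).card ≤ Bmax := by
    intro ρ hρ
    obtain ⟨h1, h2⟩ := hB _ (hredτ _ ρ hρ)
    have h3 := card_siteB_windows_le w vg hvg (ℓ + 1) ρ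
    have h4 := le_card_siteB_windows_add w vg hvg (ℓ + 1) ρ
    constructor
    · omega
    · exact h3.trans h2
  have hB'' : ∀ ρ : ℕ → Fin k × Bool,
      (∀ j, j + 1 < (ℓ + 1) + 2 → ρ (j + 1) ≠ ((ρ j).1, !(ρ j).2)) →
      ((Finset.Icc (2 * (ℓ + 1) + 3) (n - (ℓ + 1) - 1)).filter fun a =>
        ∀ j, j < (ℓ + 1) + 2 → vg (a - (ℓ + 1) - 1 + j) = ρ j).card ≤ Bmax := by
    intro ρ hρ
    exact (card_siteA_windows_le w vg hvg (ℓ + 1) ρ).trans (hB _ (hredτ _ ρ hρ)).2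
  -- the deterministic bound
  have hmain := four_mul_cl_pow_le_of_patternCounts w hvc vg hvg hred' ℓ (2 * (ℓ + 1) + 3)
    (n - (ℓ + 1) - 1) (by omega) (by omega) Amin Amax (Bmin - (ℓ + 1)) Bmax hA' hB' hB''
  have en : n - (ℓ + 1) - 1 = n - ℓ - 1 - 1 := by omega
  rw [en] at hmain
  -- `scl ≤ cl(w^{N'}) / N'`
  set N' : ℕ := 3 * (ℓ + 1) * (((2 * k - 2) * (2 * k - 2) * Bmax) *
    ((2 * k - 2) * (2 * k - 2) * Amax)) with hN'
  rcases Nat.eq_zero_or_pos N' with hN0 | hNpos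
  · -- degenerate: `N' = 0`, the `scl` term vanishes
    rw [hN0] at hmain ⊢
    simp only [Nat.cast_zero, mul_zero, zero_mul, zero_add] at hmain ⊢
    have h' : (3 * (ℓ + 1) - 1) * ((n - ℓ - 1 - 1 + 1 - (2 * (ℓ + 1) + 3)) *
        ((2 * k - 2) * (2 * k - 2) * (Bmin - (ℓ + 1))) * ((2 * k - 2) * (2 * k - 2) * Amin)) ≤
        2 + ((ℓ + 1) + 1) * (3 * ((2 * k - 2) * (2 * k - 2)) *
          ((Amax - Amin) * ((n - ℓ - 1 - 1 + 1 - (2 * (ℓ + 1) + 3)) * ((2 * k - 2) * (2 * k - 2) * Bmax))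
            + Amax * (2 * (ℓ + 1) * ((2 * k - 2) * (2 * k - 2) * Bmax)))) := by omega
    exact_mod_cast h'
  have hscl := stableCommutatorLength_le_div (FreeGroup.mk (List.ofFn w)) (n := N') (by omega)
  have hNR : (0 : ℝ) < N' := by exact_mod_cast hNpos
  rw [le_div_iff₀ hNR] at hscl
  have hmainR : (4 * (commutatorLength (FreeGroup.mk (List.ofFn w) ^ N') : ℝ)) +
      (((3 * (ℓ + 1) - 1) * ((n - ℓ - 1 - 1 + 1 - (2 * (ℓ + 1) + 3)) *
        ((2 * k - 2) * (2 * k - 2) * (Bmin - (ℓ + 1))) * ((2 * k - 2) * (2 * k - 2) * Amin)) : ℕ) : ℝ)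
      ≤ ((N' * n + 2 + ((ℓ + 1) + 1) * (3 * ((2 * k - 2) * (2 * k - 2)) *
        ((Amax - Amin) * ((n - ℓ - 1 - 1 + 1 - (2 * (ℓ + 1) + 3)) *
          ((2 * k - 2) * (2 * k - 2) * Bmax)) + Amax * (2 * (ℓ + 1) *
            ((2 * k - 2) * (2 * k - 2) * Bmax)))) : ℕ) : ℝ) := by
    exact_mod_cast hmain
  nlinarith [hscl, hmainR, stableCommutatorLength_nonneg (FreeGroup.mk (List.ofFn w))]

end PerWord

section BadSet

open Finset

open scoped Classical

/-- **The words with a badly distributed subword are rare (CW Prop. 2.3, union bound).** For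
`k ≥ 2`, `0 ≤ η ≤ 1` and `h = ℓ + 1`: the reduced words of length `n` for which some reduced word
of length `2h + 2` or `h + 2` (gap `h`) has a subword count `≥ (1+η) n p₊` or
`≤ (1−η)(n − 2S) p₋` number at most
`(|F_{2h+2}| · 2 S₂ e^{−η² T₂ p₂₋/4} + |F_{h+2}| · 2 S₁ e^{−η² T₁ p₁₋/4}) |F_n|`.
[cite: CalegariWalker2013, Prop. 2.3 and Lemma 4.7] -/
theorem card_filter_badCounts_le (k n ℓ : ℕ) (hk : 2 ≤ k) {η : ℝ} (hη : 0 ≤ η) (hη1 : η ≤ 1) :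
    (((reducedWords k n).filter fun w : Fin n → Fin k × Bool =>
      ¬ ((∀ σ ∈ reducedWords k (2 * (ℓ + 1) + 1 + 1),
        ⌈(1 - η) * (((n : ℝ) - 2 * ((ℓ + 1) + 1 + (2 * (ℓ + 1) + 1 + 1) : ℕ)) *
          (((2 * k - 1 : ℝ) ^ ((ℓ + 1) + 2) - 2 * k - 1) /
            (2 * k * (2 * k - 1 : ℝ) ^ ((ℓ + 1) + 1 + (2 * (ℓ + 1) + 1 + 1)))))⌉₊ ≤
        ((Finset.range (n - ((ℓ + 1) + 1 + (2 * (ℓ + 1) + 1)))).filter fun J => 1 ≤ J ∧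
          ∃ hJ : J + ((ℓ + 1) + 1) + (2 * (ℓ + 1) + 1) < n, ∀ q : Fin (2 * (ℓ + 1) + 1 + 1),
            w ⟨J + ((ℓ + 1) + 1) + q, by omega⟩ = σ q).card ∧
        ((Finset.range (n - ((ℓ + 1) + 1 + (2 * (ℓ + 1) + 1)))).filter fun J => 1 ≤ J ∧
          ∃ hJ : J + ((ℓ + 1) + 1) + (2 * (ℓ + 1) + 1) < n, ∀ q : Fin (2 * (ℓ + 1) + 1 + 1),
            w ⟨J + ((ℓ + 1) + 1) + q, by omega⟩ = σ q).card ≤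
        ⌊(1 + η) * (n * (((2 * k - 1 : ℝ) ^ ((ℓ + 1) + 2) + 2 * k + 1) /
          (2 * k * (2 * k - 1 : ℝ) ^ ((ℓ + 1) + 1 + (2 * (ℓ + 1) + 1 + 1)))))⌋₊) ∧
      (∀ ρ ∈ reducedWords k ((ℓ + 1) + 1 + 1),
        ⌈(1 - η) * (((n : ℝ) - 2 * ((ℓ + 1) + 1 + ((ℓ + 1) + 1 + 1) : ℕ)) *
          (((2 * k - 1 : ℝ) ^ ((ℓ + 1) + 2) - 2 * k - 1) /
            (2 * k * (2 * k - 1 : ℝ) ^ ((ℓ + 1) + 1 + ((ℓ + 1) + 1 + 1)))))⌉₊ ≤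
        ((Finset.range (n - ((ℓ + 1) + 1 + ((ℓ + 1) + 1)))).filter fun J => 1 ≤ J ∧
          ∃ hJ : J + ((ℓ + 1) + 1) + ((ℓ + 1) + 1) < n, ∀ q : Fin ((ℓ + 1) + 1 + 1),
            w ⟨J + ((ℓ + 1) + 1) + q, by omega⟩ = ρ q).card ∧
        ((Finset.range (n - ((ℓ + 1) + 1 + ((ℓ + 1) + 1)))).filter fun J => 1 ≤ J ∧
          ∃ hJ : J + ((ℓ + 1) + 1) + ((ℓ + 1) + 1) < n, ∀ q : Fin ((ℓ + 1) + 1 + 1),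
            w ⟨J + ((ℓ + 1) + 1) + q, by omega⟩ = ρ q).card ≤
        ⌊(1 + η) * (n * (((2 * k - 1 : ℝ) ^ ((ℓ + 1) + 2) + 2 * k + 1) /
          (2 * k * (2 * k - 1 : ℝ) ^ ((ℓ + 1) + 1 + ((ℓ + 1) + 1 + 1)))))⌋₊))).card : ℝ) ≤
    (((reducedWords k (2 * (ℓ + 1) + 1 + 1)).card : ℝ) *
        (2 * ((ℓ + 1) + 1 + (2 * (ℓ + 1) + 1 + 1) : ℕ) *
          Real.exp (-(η ^ 2 * ((((n - ((ℓ + 1) + 1 + (2 * (ℓ + 1) + 1 + 1))) /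
            ((ℓ + 1) + 1 + (2 * (ℓ + 1) + 1 + 1)) : ℕ) : ℝ) *
            (((2 * k - 1 : ℝ) ^ ((ℓ + 1) + 2) - 2 * k - 1) /
              (2 * k * (2 * k - 1 : ℝ) ^ ((ℓ + 1) + 1 + (2 * (ℓ + 1) + 1 + 1))))) / 4))) +
      ((reducedWords k ((ℓ + 1) + 1 + 1)).card : ℝ) *
        (2 * ((ℓ + 1) + 1 + ((ℓ + 1) + 1 + 1) : ℕ) *
          Real.exp (-(η ^ 2 * ((((n - ((ℓ + 1) + 1 + ((ℓ + 1) + 1 + 1))) /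
            ((ℓ + 1) + 1 + ((ℓ + 1) + 1 + 1)) : ℕ) : ℝ) *
            (((2 * k - 1 : ℝ) ^ ((ℓ + 1) + 2) - 2 * k - 1) /
              (2 * k * (2 * k - 1 : ℝ) ^ ((ℓ + 1) + 1 + ((ℓ + 1) + 1 + 1))))) / 4)))) *
      ((reducedWords k n).card : ℝ) := by
  classical
  -- abbreviations
  set g := ℓ + 1 with hg
  set L2 := 2 * (ℓ + 1) + 1 with hL2
  set L1 := (ℓ + 1) + 1 with hL1
  set q : ℝ := 2 * k - 1 with hq
  have hk2 : (2 : ℝ) ≤ k := by exact_mod_cast hk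
  have hq1 : (1 : ℝ) ≤ q := by rw [hq]; linarith
  -- the probabilities
  set pp2 : ℝ := (q ^ (g + 2) + 2 * k + 1) / (2 * k * q ^ (g + 1 + (L2 + 1))) with hpp2
  set pm2 : ℝ := (q ^ (g + 2) - 2 * k - 1) / (2 * k * q ^ (g + 1 + (L2 + 1))) with hpm2
  set pp1 : ℝ := (q ^ (g + 2) + 2 * k + 1) / (2 * k * q ^ (g + 1 + (L1 + 1))) with hpp1
  set pm1 : ℝ := (q ^ (g + 2) - 2 * k - 1) / (2 * k * q ^ (g + 1 + (L1 + 1))) with hpm1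
  have hpm2_le : pm2 ≤ pp2 := by
    rw [hpm2, hpp2]
    apply div_le_div_of_nonneg_right _ (by positivity)
    linarith
  have hpm1_le : pm1 ≤ pp1 := by
    rw [hpm1, hpp1]
    apply div_le_div_of_nonneg_right _ (by positivity)
    linarith
  have hpp2_nonneg : 0 ≤ pp2 := by rw [hpp2]; positivity
  have hpp1_nonneg : 0 ≤ pp1 := by rw [hpp1]; positivity
  -- the counts
  let cnt2 : (Fin (L2 + 1) → Fin k × Bool) → (Fin n → Fin k × Bool) → ℕ := fun σ w =>
    ((Finset.range (n - (g + 1 + L2))).filter fun J => 1 ≤ J ∧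
      ∃ hJ : J + (g + 1) + L2 < n, ∀ q : Fin (L2 + 1), w ⟨J + (g + 1) + q, by omega⟩ = σ q).card
  let cnt1 : (Fin (L1 + 1) → Fin k × Bool) → (Fin n → Fin k × Bool) → ℕ := fun ρ w =>
    ((Finset.range (n - (g + 1 + L1))).filter fun J => 1 ≤ J ∧
      ∃ hJ : J + (g + 1) + L1 < n, ∀ q : Fin (L1 + 1), w ⟨J + (g + 1) + q, by omega⟩ = ρ q).card
  -- the four families of tail events
  let U2 : (Fin (L2 + 1) → Fin k × Bool) → Finset (Fin n → Fin k × Bool) := fun σ =>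
    (reducedWords k n).filter fun w => (1 + η) * (n * pp2) ≤ (cnt2 σ w : ℝ)
  let D2 : (Fin (L2 + 1) → Fin k × Bool) → Finset (Fin n → Fin k × Bool) := fun σ =>
    (reducedWords k n).filter fun w =>
      (cnt2 σ w : ℝ) ≤ (1 - η) * (((n : ℝ) - 2 * (g + 1 + (L2 + 1) : ℕ)) * pm2)
  let U1 : (Fin (L1 + 1) → Fin k × Bool) → Finset (Fin n → Fin k × Bool) := fun ρ =>
    (reducedWords k n).filter fun w => (1 + η) * (n * pp1) ≤ (cnt1 ρ w : ℝ)
  let D1 : (Fin (L1 + 1) → Fin k × Bool) → Finset (Fin n → Fin k × Bool) := fun ρ =>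
    (reducedWords k n).filter fun w =>
      (cnt1 ρ w : ℝ) ≤ (1 - η) * (((n : ℝ) - 2 * (g + 1 + (L1 + 1) : ℕ)) * pm1)
  -- their measures (Lemma 2.5 / Prop. 2.3 in the finite form)
  set S2 : ℕ := g + 1 + (L2 + 1) with hS2
  set S1 : ℕ := g + 1 + (L1 + 1) with hS1
  set E2 : ℝ := Real.exp (-(η ^ 2 * ((((n - S2) / S2 : ℕ) : ℝ) * pm2) / 4)) with hE2
  set E1 : ℝ := Real.exp (-(η ^ 2 * ((((n - S1) / S1 : ℕ) : ℝ) * pm1) / 4)) with hE1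
  set Fn : ℝ := ((reducedWords k n).card : ℝ) with hFn
  have hU2 : ∀ σ ∈ reducedWords k (L2 + 1), ((U2 σ).card : ℝ) ≤ S2 * Fn * E2 := by
    intro σ hσ
    have h := card_filter_subwordCount_ge_le k n g L2 hk σ hσ hη (by linarith)
    refine h.trans ?_
    apply mul_le_mul_of_nonneg_left _ (by positivity)
    rw [hE2, Real.exp_le_exp]
    have h0 : 0 ≤ η ^ 2 * (((n - S2) / S2 : ℕ) : ℝ) := by positivity
    nlinarith
  have hD2 : ∀ σ ∈ reducedWords k (L2 + 1), ((D2 σ).card : ℝ) ≤ S2 * Fn * E2 := by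
    intro σ hσ
    exact card_filter_subwordCount_le_le k n g L2 hk σ hσ hη hη1
  have hU1 : ∀ ρ ∈ reducedWords k (L1 + 1), ((U1 ρ).card : ℝ) ≤ S1 * Fn * E1 := by
    intro ρ hρ
    have h := card_filter_subwordCount_ge_le k n g L1 hk ρ hρ hη (by linarith)
    refine h.trans ?_
    apply mul_le_mul_of_nonneg_left _ (by positivity)
    rw [hE1, Real.exp_le_exp]
    have h0 : 0 ≤ η ^ 2 * (((n - S1) / S1 : ℕ) : ℝ) := by positivity
    nlinarith
  have hD1 : ∀ ρ ∈ reducedWords k (L1 + 1), ((D1 ρ).card : ℝ) ≤ S1 * Fn * E1 := by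
    intro ρ hρ
    exact card_filter_subwordCount_le_le k n g L1 hk ρ hρ hη hη1
  -- the bad set is contained in the union of the tail events
  have hsub : ((reducedWords k n).filter fun w => ¬ ((∀ σ ∈ reducedWords k (L2 + 1),
        ⌈(1 - η) * (((n : ℝ) - 2 * (g + 1 + (L2 + 1) : ℕ)) * pm2)⌉₊ ≤ cnt2 σ w ∧
          cnt2 σ w ≤ ⌊(1 + η) * (n * pp2)⌋₊) ∧
      (∀ ρ ∈ reducedWords k (L1 + 1),
        ⌈(1 - η) * (((n : ℝ) - 2 * (g + 1 + (L1 + 1) : ℕ)) * pm1)⌉₊ ≤ cnt1 ρ w ∧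
          cnt1 ρ w ≤ ⌊(1 + η) * (n * pp1)⌋₊))) ⊆
      ((reducedWords k (L2 + 1)).biUnion fun σ => U2 σ ∪ D2 σ) ∪
        ((reducedWords k (L1 + 1)).biUnion fun ρ => U1 ρ ∪ D1 ρ) := by
    intro w hw
    rw [Finset.mem_filter] at hw
    obtain ⟨hwF, hbad⟩ := hw
    rw [Finset.mem_union, Finset.mem_biUnion, Finset.mem_biUnion]
    by_contra hcon
    rw [not_or, not_exists, not_exists] at hcon
    obtain ⟨h2, h1⟩ := hcon
    apply hbad
    constructor
    · intro σ hσ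
      have h := h2 σ
      rw [not_and, Finset.mem_union, not_or] at h
      obtain ⟨hnU, hnD⟩ := h hσ
      simp only [U2, D2, Finset.mem_filter, not_and, not_le] at hnU hnD
      constructor
      · rw [Nat.ceil_le]
        exact (hnD hwF).le
      · apply Nat.le_floor
        exact (hnU hwF).le
    · intro ρ hρ
      have h := h1 ρ
      rw [not_and, Finset.mem_union, not_or] at h
      obtain ⟨hnU, hnD⟩ := h hρ
      simp only [U1, D1, Finset.mem_filter, not_and, not_le] at hnU hnD
      constructor
      · rw [Nat.ceil_le]
        exact (hnD hwF).le
      · apply Nat.le_floor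
        exact (hnU hwF).le
  -- counting
  have hcard := Finset.card_le_card hsub
  have hR : (((((reducedWords k (L2 + 1)).biUnion fun σ => U2 σ ∪ D2 σ) ∪
      ((reducedWords k (L1 + 1)).biUnion fun ρ => U1 ρ ∪ D1 ρ)).card : ℕ) : ℝ) ≤
      ((reducedWords k (L2 + 1)).card : ℝ) * (2 * S2 * E2) * Fn +
        ((reducedWords k (L1 + 1)).card : ℝ) * (2 * S1 * E1) * Fn := by
    calc (((((reducedWords k (L2 + 1)).biUnion fun σ => U2 σ ∪ D2 σ) ∪
          ((reducedWords k (L1 + 1)).biUnion fun ρ => U1 ρ ∪ D1 ρ)).card : ℕ) : ℝ)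
        ≤ ((((reducedWords k (L2 + 1)).biUnion fun σ => U2 σ ∪ D2 σ).card : ℕ) : ℝ) +
            ((((reducedWords k (L1 + 1)).biUnion fun ρ => U1 ρ ∪ D1 ρ).card : ℕ) : ℝ) := by
          exact_mod_cast Finset.card_union_le _ _
      _ ≤ (∑ σ ∈ reducedWords k (L2 + 1), (((U2 σ ∪ D2 σ).card : ℕ) : ℝ)) +
            ∑ ρ ∈ reducedWords k (L1 + 1), (((U1 ρ ∪ D1 ρ).card : ℕ) : ℝ) := by
          exact add_le_add (by exact_mod_cast Finset.card_biUnion_le)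
            (by exact_mod_cast Finset.card_biUnion_le)
      _ ≤ (∑ _σ ∈ reducedWords k (L2 + 1), 2 * (S2 * Fn * E2)) +
            ∑ _ρ ∈ reducedWords k (L1 + 1), 2 * (S1 * Fn * E1) := by
          apply add_le_add
          · refine Finset.sum_le_sum fun σ hσ => ?_
            calc (((U2 σ ∪ D2 σ).card : ℕ) : ℝ) ≤ ((U2 σ).card : ℝ) + ((D2 σ).card : ℝ) := by
                  exact_mod_cast Finset.card_union_le _ _
              _ ≤ S2 * Fn * E2 + S2 * Fn * E2 := add_le_add (hU2 σ hσ) (hD2 σ hσ)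
              _ = 2 * (S2 * Fn * E2) := by ring
          · refine Finset.sum_le_sum fun ρ hρ => ?_
            calc (((U1 ρ ∪ D1 ρ).card : ℕ) : ℝ) ≤ ((U1 ρ).card : ℝ) + ((D1 ρ).card : ℝ) := by
                  exact_mod_cast Finset.card_union_le _ _
              _ ≤ S1 * Fn * E1 + S1 * Fn * E1 := add_le_add (hU1 ρ hρ) (hD1 ρ hρ)
              _ = 2 * (S1 * Fn * E1) := by ring
      _ = _ := by
          rw [Finset.sum_const, Finset.sum_const, nsmul_eq_mul, nsmul_eq_mul]
          ring
  calc _ ≤ (((((reducedWords k (L2 + 1)).biUnion fun σ => U2 σ ∪ D2 σ) ∪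
          ((reducedWords k (L1 + 1)).biUnion fun ρ => U1 ρ ∪ D1 ρ)).card : ℕ) : ℝ) := by
        exact_mod_cast hcard
    _ ≤ _ := hR
    _ = _ := by ring

end BadSet

end Literature.GroupTheory.CombinatorialGroupTheory

end
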